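import Mathlib.RingTheory.MvPowerSeries.Basic
import Mathlib.RingTheory.MvPowerSeries.Order
import Mathlib.Data.Nat.Choose.Sum
import Mathlib.Tactic.IntervalCases
import HarnessLib

/-!
# [OURS · L1 W4.6 rung (iii-2)] THE W-WALK MODEL: the inherited presentation `g = z^p + f`, `f ∈ K⟦t, y, z⟧`, of a window germ at a
# thread point, and its transform under a point blow-up at a singular direction — COEFFICIENTWISE definitions

Cell `res-hironaka`, LADDER-RESOLUTION rung L (D-0089), slot W4.6 rung (iii) «purely inseparable surface Moh window»; seat res-L1-s46-pv-5
(gen 6), plan `HOME/L/res-L1-s46-pv-5/W-WALK-PLAN.md`. Host route MarkedTransfer (stmt-ResolutionOfSingularities-16155), `--supports … --as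
helper`; kind definition (model vocabulary only, no «replaces the role» cells: the rung statements are o1's).

WHAT. Variables `Option (Fin 2)`: `t = X (some 0)` (the NEWEST exceptional parameter), `y = X (some 1)`, `z = X none` (the directrix
variable), as in res-L1-s46-pv-6's frame. A thread point of an in-regime permissible sequence carries, in Cohen coordinates, a generator
`g = z^p + f` of `J·𝒪̂` with `f ∈ (t^{r_t} y^{r_y})` (boundary letters) and `p + 1 ≤ ord f = d < 2p`; the singular directions are `(1 : λ : 0)`
(chart `t`, `y/t = λ`) and `(0 : 1 : 0)` (tangent to `{t = 0}`, handled by the swap `t ↔ y`). This file fixes the EXPLICIT COEFFICIENT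
FORMULAS of the transform (no `MvPowerSeries.subst`; the identification with the chart substitution of res-L1-s46-pv-2's dictionary is a
separate brick):
* `mk3 a b c` — the exponent `t^a y^b z^c`; `expT/expY/expZ`;
* `chartT p l f` — `t^{-p} · f(t, t(y + l), t z)`: coefficient of `t^m y^i z^c` is `Σ_b C(b,i) l^{b−i} · [t^{m+p−b−c} y^b z^c] f`;
* `shearZ γ f` — `f(t, y, z − γ t)`: coefficient of `t^m y^b z^j` is `Σ_i C(j+i, i) (−γ)^i · [t^{m−i} y^b z^{j+i}] f`;
* `stepT p l γ f := shearZ γ (chartT p l f − γ^p t^p)` — the step at the direction `(1 : l : 0)` with cleaning root `γ` (`z ↦ z − γt`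
  absorbs `γ^p t^p`; for the germ one takes `γ^p =` the coefficient of `t^p`, but the laws hold for every `γ`);
* `swapTY f` — `t ↔ y` (the sharp-vertical step is `stepT p 0 γ ∘ swapTY`);
* predicates `BDiv r_t r_y f` (every monomial of `f` is divisible by `t^{r_t} y^{r_y}`), `LowVanish n f` (no monomial of degree `< n`),
  `YAdapted`, `TAdapted`, `NDz` (some monomial of the given degree is `z`-free), and the twisted residue coefficients `pcoef`.
Elementary API: degrees, coefficient formulas, `BDiv`/`LowVanish` of a step. The LAWS are in `…WWalkLaws.lean`.

HONEST FRAMING. OURS model vocabulary; nothing here is a statement of H. Hironaka's manuscript [Hironaka2017] and nothing of it is used.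
AI-written; AI review is weaker than expert review. No `sorry`; axioms standard. Reference for the chart formulas: H. Hauser, Bull. AMS 47
(2010) §§F–G [Hauser2010].
-/

noncomputable section

set_option linter.dupNamespace false -- mandated namespace of this single-conjunct summit

open MvPowerSeries Finset

namespace Summit.ResolutionOfSingularities.ResolutionOfSingularities.Theorems

namespace CampaignW46

namespace WWalk

variable {K : Type*} [CommRing K]

/-! ## §1 Exponents `t^a y^b z^c` -/

/-- The exponent vector of `t^a y^b z^c` (`t = some 0`, `y = some 1`, `z = none`). [folklore] -/
def mk3 (a b c : ℕ) : Option (Fin 2) →₀ ℕ :=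
  Finsupp.single (some 0) a + Finsupp.single (some 1) b + Finsupp.single none c

/-- The `t`-exponent of `mk3`. [folklore] -/
@[simp] theorem mk3_t (a b c : ℕ) : mk3 a b c (some 0) = a := by simp [mk3]
/-- The `y`-exponent of `mk3`. [folklore] -/
@[simp] theorem mk3_y (a b c : ℕ) : mk3 a b c (some 1) = b := by simp [mk3]
/-- The `z`-exponent of `mk3`. [folklore] -/
@[simp] theorem mk3_z (a b c : ℕ) : mk3 a b c none = c := by simp [mk3]

/-- Every exponent is some `mk3`. [folklore] -/
theorem mk3_eta (e : Option (Fin 2) →₀ ℕ) : mk3 (e (some 0)) (e (some 1)) (e none) = e := by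
  ext o
  rcases o with _ | ⟨i, hi⟩
  · simp
  · interval_cases i <;> simp

/-- `mk3` is injective. [folklore] -/
theorem mk3_inj {a b c a' b' c' : ℕ} : mk3 a b c = mk3 a' b' c' ↔ a = a' ∧ b = b' ∧ c = c' := by
  refine ⟨fun h => ?_, fun ⟨h1, h2, h3⟩ => by rw [h1, h2, h3]⟩
  have h1 := congrArg (fun e => e (some 0)) h
  have h2 := congrArg (fun e => e (some 1)) h
  have h3 := congrArg (fun e => e none) h
  simp only [mk3_t, mk3_y, mk3_z] at h1 h2 h3
  exact ⟨h1, h2, h3⟩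

/-- The degree of `t^a y^b z^c` is `a + b + c`. [folklore] -/
@[simp] theorem degree_mk3 (a b c : ℕ) : (mk3 a b c).degree = a + b + c := by
  simp [mk3, map_add, Finsupp.degree_single]

/-- The degree of an exponent in the three letters. [folklore] -/
theorem degree_eq (e : Option (Fin 2) →₀ ℕ) : e.degree = e (some 0) + e (some 1) + e none := by
  conv_lhs => rw [← mk3_eta e]
  exact degree_mk3 _ _ _

/-! ## §2 The operations, coefficientwise -/

/-- **`chartT p l f = t^{-p}·f(t, t(y + l), t z)`**: the controlled transform of `f` at the direction `(1 : l : 0)` (chart `t`, point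
`y/t = l`), BEFORE cleaning. Coefficient of `t^m y^i z^c`: `Σ_{b} C(b, i) l^{b−i} [t^{m+p−b−c} y^b z^c] f` (the monomial
`t^a y^b z^c ↦ t^{a+b+c−p} (y + l)^b z^c`). [cite: Hauser2010, §F (chart expressions of a point blowup)] -/
def chartT (p : ℕ) (l : K) (f : MvPowerSeries (Option (Fin 2)) K) : MvPowerSeries (Option (Fin 2)) K :=
  fun e => ∑ b ∈ range (e (some 0) + p + 1),
    if b + e none ≤ e (some 0) + p then
      (b.choose (e (some 1)) : K) * l ^ (b - e (some 1)) * coeff (mk3 (e (some 0) + p - b - e none) b (e none)) f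
    else 0

/-- **`shearZ γ f = f(t, y, z − γt)`** (the cleaning change of the directrix variable). Coefficient of `t^m y^b z^j`:
`Σ_{i ≤ m} C(j+i, i) (−γ)^i [t^{m−i} y^b z^{j+i}] f`. [folklore] -/
def shearZ (γ : K) (f : MvPowerSeries (Option (Fin 2)) K) : MvPowerSeries (Option (Fin 2)) K :=
  fun e => ∑ i ∈ range (e (some 0) + 1),
    ((e none + i).choose i : K) * (-γ) ^ i * coeff (mk3 (e (some 0) - i) (e (some 1)) (e none + i)) f

/-- **The step at the direction `(1 : l : 0)` with cleaning root `γ`**: `stepT p l γ f = shearZ γ (chartT p l f − γ^p t^p)` — so that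
`z^p + chartT p l f = (z′)^p + stepT p l γ f` with `z′ = z + γ t` read in the coordinates `(t, y, z′)`. [cite: Hauser2010, §§F–G (point
blowup followed by cleaning)] -/
def stepT (p : ℕ) (l γ : K) (f : MvPowerSeries (Option (Fin 2)) K) : MvPowerSeries (Option (Fin 2)) K :=
  shearZ γ (chartT p l f - C (γ ^ p) * X (some 0) ^ p)

/-- **The swap `t ↔ y`** (the sharp-vertical direction `(0 : 1 : 0)` of the frame `(t, y)` is the direction `(1 : 0 : 0)` of the
frame `(y, t)`). [folklore] -/
def swapTY (f : MvPowerSeries (Option (Fin 2)) K) : MvPowerSeries (Option (Fin 2)) K :=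
  fun e => coeff (mk3 (e (some 1)) (e (some 0)) (e none)) f

/-! ## §3 Predicates on a state `(f, r_t, r_y)` -/

/-- **Boundary divisibility**: every monomial of `f` is divisible by `t^{r_t} y^{r_y}`. [folklore] -/
def BDiv (rt ry : ℕ) (f : MvPowerSeries (Option (Fin 2)) K) : Prop :=
  ∀ e, coeff e f ≠ 0 → rt ≤ e (some 0) ∧ ry ≤ e (some 1)

/-- `f` has no monomial of degree `< n` (`n ≤ ord f`). [folklore] -/
def LowVanish (n : ℕ) (f : MvPowerSeries (Option (Fin 2)) K) : Prop :=
  ∀ e, e.degree < n → coeff e f = 0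

/-- **`y`-ADAPTED state of order `d` with boundary `(r_t, r_y)`**: the monomial `t^{r_t} y^{d − r_t}` (the `Y^σ`-corner of the residual
cone `Q`, `σ = d − r_t − r_y`) occurs in `f`. [folklore] -/
def YAdapted (rt d : ℕ) (f : MvPowerSeries (Option (Fin 2)) K) : Prop :=
  coeff (mk3 rt (d - rt) 0) f ≠ 0

/-- **`t`-ADAPTED**: the monomial `t^{d − r_y} y^{r_y}` (the `T^σ`-corner) occurs in `f`. [folklore] -/
def TAdapted (ry d : ℕ) (f : MvPowerSeries (Option (Fin 2)) K) : Prop :=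
  coeff (mk3 (d - ry) ry 0) f ≠ 0

/-- **(ND) in degree `d`**: some `z`-FREE monomial of degree `d` occurs in `f` (the degree-`d` form of `f` is not divisible by `Z`). [folklore] -/
def NDz (d : ℕ) (f : MvPowerSeries (Option (Fin 2)) K) : Prop :=
  ∃ a b, a + b = d ∧ coeff (mk3 a b 0) f ≠ 0

/-- **The twisted residue coefficients** `P̃_{i,c}` of the state `(f, r_t, r_y)` of order `d` at the direction `l`: with `σ = d − r_t − r_y`,
`P̃_{i,c} = Σ_{b′} C(b′, i) l^{b′−i} [t^{d − r_y − b′ − c} y^{b′ + r_y} z^c] f` — the coefficients of `Q(1, y + l, z)`, `Q` the degree-`d` form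
of `f` divided by `T^{r_t} Y^{r_y}`. [cite: Hauser2010, §F] -/
def pcoef (ry d : ℕ) (l : K) (f : MvPowerSeries (Option (Fin 2)) K) (i c : ℕ) : K :=
  ∑ b' ∈ range (d + 1), if ry + b' + c ≤ d then
    (b'.choose i : K) * l ^ (b' - i) * coeff (mk3 (d - ry - b' - c) (b' + ry) c) f else 0

/-! ## §4 Coefficient formulas -/

/-- The coefficient formula of `chartT`. [cite: Hauser2010, §F] -/
theorem coeff_chartT (p : ℕ) (l : K) (f : MvPowerSeries (Option (Fin 2)) K) (m i c : ℕ) :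
    coeff (mk3 m i c) (chartT p l f) = ∑ b ∈ range (m + p + 1),
      if b + c ≤ m + p then (b.choose i : K) * l ^ (b - i) * coeff (mk3 (m + p - b - c) b c) f else 0 := by
  show chartT p l f (mk3 m i c) = _
  simp only [chartT, mk3_t, mk3_y, mk3_z]

/-- The coefficient formula of `shearZ`. [folklore] -/
theorem coeff_shearZ (γ : K) (f : MvPowerSeries (Option (Fin 2)) K) (m b j : ℕ) :
    coeff (mk3 m b j) (shearZ γ f) =
      ∑ i ∈ range (m + 1), ((j + i).choose i : K) * (-γ) ^ i * coeff (mk3 (m - i) b (j + i)) f := by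
  show shearZ γ f (mk3 m b j) = _
  simp only [shearZ, mk3_t, mk3_y, mk3_z]

/-- The coefficient formula of `swapTY`. [folklore] -/
theorem coeff_swapTY (f : MvPowerSeries (Option (Fin 2)) K) (a b c : ℕ) :
    coeff (mk3 a b c) (swapTY f) = coeff (mk3 b a c) f := by
  show swapTY f (mk3 a b c) = _
  simp only [swapTY, mk3_t, mk3_y, mk3_z]

/-- `swapTY` is an involution. [folklore] -/
theorem swapTY_swapTY (f : MvPowerSeries (Option (Fin 2)) K) : swapTY (swapTY f) = f := by
  ext e
  rw [← mk3_eta e, coeff_swapTY, coeff_swapTY]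

/-- Coefficient of `t^m y^b z^j` in `γ^p t^p`. [folklore] -/
theorem coeff_C_mul_X_pow (γ : K) (p m b j : ℕ) :
    coeff (mk3 m b j) (C (γ ^ p) * X (some 0) ^ p : MvPowerSeries (Option (Fin 2)) K) =
      if m = p ∧ b = 0 ∧ j = 0 then γ ^ p else 0 := by
  rw [coeff_C_mul, X_pow_eq, coeff_monomial]
  have : (mk3 m b j = Finsupp.single (some 0) p) ↔ (m = p ∧ b = 0 ∧ j = 0) := by
    rw [show Finsupp.single (some 0) p = mk3 p 0 0 by simp [mk3], mk3_inj]
  by_cases h : m = p ∧ b = 0 ∧ j = 0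
  · rw [if_pos (this.mpr h), if_pos h, mul_one]
  · rw [if_neg (fun h' => h (this.mp h')), if_neg h, mul_zero]

/-! ## §5 What a step does to the boundary and to low degrees -/

/-- `chartT` lands in `(t^{d − p})` and keeps the `y`-letter at `l = 0`: if `f` has no monomial of degree `< d` and all its monomials
are divisible by `y^{r_y}`, then every monomial `t^m y^i z^c` of `chartT p l f` has `m + p ≥ d`, and `i ≥ r_y` when `l = 0`. [folklore] -/
theorem coeff_chartT_eq_zero_of_lt {p : ℕ} {l : K} {f : MvPowerSeries (Option (Fin 2)) K} {d : ℕ} (hlow : LowVanish d f)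
    {m i c : ℕ} (hm : m + p < d) : coeff (mk3 m i c) (chartT p l f) = 0 := by
  rw [coeff_chartT]
  refine sum_eq_zero fun b hb => ?_
  split_ifs with h
  · rw [hlow _ (by rw [degree_mk3]; omega), mul_zero]
  · rfl

/-- At `l = 0` the `y`-letter is kept: monomials with `y`-exponent `< r_y` do not occur in `chartT p 0 f`. [folklore] -/
theorem coeff_chartT_eq_zero_of_lt_ry {p : ℕ} {f : MvPowerSeries (Option (Fin 2)) K} {rt ry : ℕ} (hB : BDiv rt ry f)
    {m i c : ℕ} (hi : i < ry) : coeff (mk3 m i c) (chartT p 0 f) = 0 := by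
  rw [coeff_chartT]
  refine sum_eq_zero fun b hb => ?_
  split_ifs with h
  · by_cases hbi : b = i
    · subst hbi
      by_cases hc : coeff (mk3 (m + p - b - c) b c) f = 0
      · rw [hc, mul_zero]
      · exact absurd (hB _ hc).2 (by simp; omega)
    · by_cases hlt : i < b
      · have : b - i ≠ 0 := by omega
        rw [zero_pow this, mul_zero, zero_mul]
      · rw [Nat.choose_eq_zero_of_lt (by omega), Nat.cast_zero, zero_mul, zero_mul]
  · rfl

/-- **A step keeps the boundary shape**: from `LowVanish d f`, `BDiv r_t r_y f`, `p + 1 ≤ d ≤ 2p` the transform `stepT p l γ f` satisfies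
`BDiv (d − p) r_y′` with `r_y′ = r_y` if `l = 0` and `r_y′ = 0` otherwise — at `l = 0` with `r_y > 0` the cleaning root must vanish
(`hγ0`; for the germ, `γ^p` is the coefficient of `t^p`, which is `0` there since every monomial carries `y^{r_y}`). [folklore] -/
theorem bdiv_stepT [DecidableEq K] {p : ℕ} {l γ : K} {f : MvPowerSeries (Option (Fin 2)) K} {d rt ry : ℕ} (hlow : LowVanish d f)
    (hB : BDiv rt ry f) (hpd : p + 1 ≤ d) (hd2 : d ≤ 2 * p) (hγ0 : l = 0 → 0 < ry → γ = 0) :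
    BDiv (d - p) (if l = 0 then ry else 0) (stepT p l γ f) := by
  intro e he
  rw [← mk3_eta e] at he
  set m := e (some 0)
  set b := e (some 1)
  set j := e none
  rw [stepT, coeff_shearZ] at he
  obtain ⟨i, hi, hne⟩ := exists_ne_zero_of_sum_ne_zero he
  rw [mem_range] at hi
  have hne' : coeff (mk3 (m - i) b (j + i)) (chartT p l f - C (γ ^ p) * X (some 0) ^ p) ≠ 0 := by
    intro h0; exact hne (by rw [h0, mul_zero])
  rw [map_sub, coeff_C_mul_X_pow] at hne'
  -- the `t`-exponent: both the chart transform and the cleaning monomial live in `(t^{d-p})`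
  have ht : d - p ≤ m := by
    by_contra hlt
    push Not at hlt
    have h1 : coeff (mk3 (m - i) b (j + i)) (chartT p l f) = 0 := coeff_chartT_eq_zero_of_lt hlow (by omega)
    rw [h1, zero_sub, neg_ne_zero] at hne'
    by_cases h : m - i = p ∧ b = 0 ∧ j + i = 0
    · omega
    · rw [if_neg h] at hne'; exact hne' rfl
  refine ⟨ht, ?_⟩
  -- the `y`-exponent (only at `l = 0`)
  by_cases hl : l = 0
  · rw [if_pos hl]
    subst hl
    by_contra hlt
    push Not at hlt
    have h1 : coeff (mk3 (m - i) b (j + i)) (chartT p (0 : K) f) = 0 := coeff_chartT_eq_zero_of_lt_ry hB hlt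
    rw [h1, zero_sub, neg_ne_zero] at hne'
    by_cases h : m - i = p ∧ b = 0 ∧ j + i = 0
    · rw [if_pos h, hγ0 rfl (by omega)] at hne'
      by_cases hp : p = 0
      · -- degenerate exponent `p = 0`: then `d ≤ 0 < 1 ≤ d`
        omega
      · exact hne' (zero_pow hp)
    · rw [if_neg h] at hne'; exact hne' rfl
  · rw [if_neg hl]; exact Nat.zero_le _

/-- `BDiv` implies the vanishing of all monomials of degree `< r_t + r_y`. [folklore] -/
theorem lowVanish_of_bdiv {rt ry : ℕ} {f : MvPowerSeries (Option (Fin 2)) K} (hB : BDiv rt ry f) : LowVanish (rt + ry) f := by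
  intro e he
  by_contra h
  have := hB e h
  rw [degree_eq] at he
  omega

/-- `swapTY` exchanges the boundary letters. [folklore] -/
theorem bdiv_swapTY {rt ry : ℕ} {f : MvPowerSeries (Option (Fin 2)) K} (hB : BDiv rt ry f) : BDiv ry rt (swapTY f) := by
  intro e he
  rw [← mk3_eta e, coeff_swapTY] at he
  have := hB _ he
  simp only [mk3_t, mk3_y] at this
  exact ⟨this.2, this.1⟩

/-- `swapTY` preserves `LowVanish`. [folklore] -/
theorem lowVanish_swapTY {n : ℕ} {f : MvPowerSeries (Option (Fin 2)) K} (h : LowVanish n f) : LowVanish n (swapTY f) := by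
  intro e he
  rw [← mk3_eta e, coeff_swapTY]
  exact h _ (by rw [degree_mk3]; rw [degree_eq] at he; omega)

/-- `swapTY` exchanges `YAdapted` and `TAdapted` (with the boundary letters exchanged). [folklore] -/
theorem tAdapted_swapTY_iff {rt d : ℕ} {f : MvPowerSeries (Option (Fin 2)) K} : TAdapted rt d (swapTY f) ↔ YAdapted rt d f := by
  rw [TAdapted, YAdapted, coeff_swapTY]

/-- `swapTY` turns `TAdapted` into `YAdapted`. [folklore] -/
theorem yAdapted_swapTY_iff {ry d : ℕ} {f : MvPowerSeries (Option (Fin 2)) K} : YAdapted ry d (swapTY f) ↔ TAdapted ry d f := by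
  rw [TAdapted, YAdapted, coeff_swapTY]

/-- `swapTY` preserves (ND). [folklore] -/
theorem ndz_swapTY_iff {d : ℕ} {f : MvPowerSeries (Option (Fin 2)) K} : NDz d (swapTY f) ↔ NDz d f := by
  constructor
  · rintro ⟨a, b, hab, h⟩
    rw [coeff_swapTY] at h
    exact ⟨b, a, by omega, h⟩
  · rintro ⟨a, b, hab, h⟩
    exact ⟨b, a, by omega, by rwa [coeff_swapTY]⟩

end WWalk

end CampaignW46

end Summit.ResolutionOfSingularities.ResolutionOfSingularities.Theorems

end
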